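import Summits.HubbardSuperconductivity.HubbardSuperconductivity.Theorems.AnisotropyChordTransferFibre3N1RowExprB

/-!
# Route `AnisotropyChord` / H0 rotor rung, LEVEL 2 row `N₁`: the `RExpr` transcription, part 2′ — CORRECTED `B̂` bracket

AMENDMENT of `…N1RowExprB` (p2 g4) found by the soundness proof of the `B̂` object (`…N1RowObjB.eval_BclosedFull`, p2 g5):
the last summand of the landed `BclosedFull` reads `(Dt)²·(d·t)·(4π² − 2t) = d³t³(4π² − 2t)`, but the hatted identity
`t³·Σ_{T′} c²c′ = −[… + t³d³(V − 2)]` needs `t³d³(V − 2) = d³t²(tV − 2t) = (Dt)²·d·(4π² − 2t)` (`tV = 4π²`) — one spurious factor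
`t` (relative size `≈ 10⁻¹²` of `B̂`; invisible in the 4-digit kernel-vs-blueprint comparison, the blueprint
HOME/hubbard-h0-rotor-p2/level2_N1_hat.py has the correct weight).  The tree is append-only, so the corrected terms are added under
NEW names: `BclosedFullC`, `B2coreC`, ★ `B2loC`, ★ `B2hiC` (the clipped tail `B2tail` is unchanged and reused); the object theorem
`…N1RowObjB.bHat_mem` and the production cell checker use these.  `BtailFull`, `BtailAt`, `blockP`, the special points are unchanged.
Computable only.
Prover seat `hubbard-h0-rotor-p2` g5; helper for piece A = stmt-HubbardSuperconductivity-23918 of rung 19089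
(`--supports`, helper class).  Nothing here proves superconductivity in the Hubbard model; computable helper definitions of ONE
conditional reduction (the GM₃ ∀L certificate, Level-2 row `N₁`); the rotor TARGET as originally worded stays FALSE (g15 verdict).
Mathlib + the tree only; no sorry.
-/

set_option linter.dupNamespace false
set_option autoImplicit false

open Literature.Analysis.ValidatedNumerics

namespace Summit.HubbardSuperconductivity.HubbardSuperconductivity.Theorems.AnisotropyChord.Transfer.Fibre3.L2.N1

/-- ★ `BClosedExpansion` hatted, CORRECTED last summand:
`t³Σ_{T′} c²c′ = −[8c_s³Ĝ21 + 4c_s²D(Ŝ₂ − ĝ₁²) + 8c_s²D T̂10 + 6c_sD²(Ŝ₁ − ĝ₁) + D²·d·(4π² − 2t)]`, `D = d·t`, `d = a²`. -/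
def BclosedFullC (M : ℕ) : RExpr :=
  .neg (rsum [ .mul (.mul (cst 8) (cube cs)) vG21,
    .mul (.mul (.mul (cst 4) (.sq cs)) Dt) (Sg2 M),
    .mul (.mul (.mul (cst 8) (.sq cs)) Dt) vT10,
    .mul (.mul (.mul (cst 6) cs) (.sq Dt)) (Sg1 M),
    .mul (.mul (.sq Dt) dd) (.sub (.mul (cst 4) vPi2) (.mul (cst 2) vT)) ])

/-- the common part of the corrected `B̂` bracket: special points + block + corrected closed outer. -/
def B2coreC (M2 : ℕ) : RExpr :=
  let M := M2 + 1
  rsum [ .mul (.sq F0h) (Fh M (1, 0)), .mul (.sq (Fh M (-1, 0))) F0h,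
    rsum ((blockP M2).map fun q => .mul (.sq (Fh M q)) (Fh M (q.1 + 1, q.2))),
    BclosedFullC M,
    .neg (rsum ((blockP M2).map fun q => .mul (.sq (ch M q)) (ch M (q.1 + 1, q.2)))) ]
/-- ★ corrected upper hatted bracket of `B̂` (tail `B2tail` unchanged). -/
def B2hiC (M2 : ℕ) : RExpr := .add (B2coreC M2) (B2tail M2)
/-- ★ corrected lower hatted bracket of `B̂`. -/
def B2loC (M2 : ℕ) : RExpr := .sub (B2coreC M2) (B2tail M2)

end Summit.HubbardSuperconductivity.HubbardSuperconductivity.Theorems.AnisotropyChord.Transfer.Fibre3.L2.N1
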